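/-
LINE 8 crux K_A ⟨stmt-QuantumFields-27724⟩ `TripleSmallBallMargin` — CLOSING FILE (LEAD g24).

`TripleSmallBallMargin` (`∃ δ > 0, e > 3/4, C: EKSymSmallBallBound 3 δ e C`) with `δ = 1/10`, `e = 4/5`: the per-eigenangle
bound `symFibre_bound` (blocks from the pair profile, one decoupling level, off-block Gaussian count, Vandermonde split, per-block
E_rob/Ψ_rob pricing, margin bookkeeping) fed through the FILE-B door `tripleSmallBallMargin_of_symFibreBound_trace` (Weyl
integration + Fubini over the first link + the `t > t₀` trivial branch).  Team: LEAD g24 with width seats w2/w3/w4/w5 of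
`ym-line-cbag-p1` (see the imports).  This settles crux K_A of LINE 8; K_B (`DirectionIncrement`) is closed, so the route's target
`Literature.Barriers.QuantumFields.EguchiKawaiBreakdown` follows by the route's assembly.  YM mass gap NOT touched
(barrier-ledger line: this is the Eguchi–Kawai breakdown direction, not a mass-gap statement).
-/
import Summits.QuantumFields.YangMills.Theses.EguchiKawaiDirectionLadder
import Summits.QuantumFields.YangMills.Theorems.EguchiKawaiDirectionLadderSymFibreBound
import Summits.QuantumFields.YangMills.Theorems.EguchiKawaiDirectionLadderSymFibreDoor
import HarnessLib

/-!
# Crux K_A of LINE 8: `TripleSmallBallMargin` (closing file)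

`tripleSmallBallMargin_proof : TripleSmallBallMargin` with `δ = 1/10`, `e = 4/5`: the per-eigenangle bound `symFibre_bound`
through the FILE-B door (Weyl integration over the first link, the `t > t₀` trivial branch).  YM mass gap NOT touched.
-/

namespace Summit.QuantumFields.YangMills.Theorems.EguchiKawaiDirectionLadder

/-- **Crux K_A of LINE 8 (`TripleSmallBallMargin`)**: there are `δ > 0`, `e > 3/4` and `C` with
`EKSymSmallBallBound 3 δ e C` — namely `δ = 1/10`, `e = 4/5`. -/
theorem tripleSmallBallMargin_proof :
    Summit.QuantumFields.YangMills.Theses.EguchiKawaiDirectionLadder.TripleSmallBallMargin := by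
  obtain ⟨C, t₀, ht₀, N₀, h⟩ := symFibre_bound
  exact tripleSmallBallMargin_of_symFibreBound_trace (by norm_num) (by norm_num) ht₀ h

end Summit.QuantumFields.YangMills.Theorems.EguchiKawaiDirectionLadder
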